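import Summits.BirchSwinnertonDyer.Rank1Residual.Iwasawa.LambdaInvariantZeros
import Summits.BirchSwinnertonDyer.Rank1Residual.Supersingular.MazurTateTwistedNonvanishingTower
import Literature.NumberTheory.EllipticCurves.PAdicLFunctionMultiplicativeInterpolation
import Literature.NumberTheory.EllipticCurves.PAdicLFunctionInterpolationHoldsProofs
import Literature.NumberTheory.EllipticCurves.PAdicBSD
import Summits.BirchSwinnertonDyer.Rank1Residual.Iwasawa.UnitCoefficientCertificate
import HarnessLib

/-!
# `λ_an < φ(pⁿ)` ⇒ no vanishing twist `L(E, χ, 1)` of order `pⁿ`; `λ_an ≤ p − 2` ⇒ none in the whole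
# cyclotomic `ℤ_p`-tower — for ANY `p`-adic `L`-function with the Mazur–Tate–Teitelbaum interpolation
# property (good ordinary / multiplicative `p`), read off the census invariant `λ_an` (cell `b2b-bsdres`;
# class-agnostic support for iw-1's (μ, λ) census, classes X1/X2/X4/X9/X10/X11; unit additive-p3, gen 7)

HONEST FRAMING (run/shared/lean/b2b/bsd-rank1-residual/, verbatim in every file): the goal of the
cell is to DELETE the COMBINATION-SHAPED residual classes of the Birch–Swinnerton-Dyer formula for
ALL analytic-rank `≤ 1` elliptic curves over `ℚ` — "full BSD formula for every rank `≤ 1` curve in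
class `C`" assembled STRICTLY from published theorems — so that the rank-`≤ 1` remainder becomes
exactly the CONSTRUCTION-SHAPED classes, which are TYPED (missing-input `Prop`s), NOT attempted.
This is not "finishing BSD". THEOREMS ONLY; the one named fact that appears (Kato, Astérisque 295,
Cor. 14.3 (2), the tree's pre-existing `kato_finite_chiPart_of_twistedLValue_ne_zero`) is displayed
as the hypothesis `hK` of the tower statements and used nowhere else; nothing about any particular
curve is asserted; nothing booked; no label changes.

## What this file proves

Let `f ∈ S₂(Γ₀(N))`, `p` a prime, `α ∈ ℚ_p^×`, and `L ∈ ℚ_p⟦T⟧` a power series with the twisted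
half of the Mazur–Tate–Teitelbaum interpolation property — for every primitive even `p`-power-order
`χ` of conductor `p^m`, `m ≥ 1`: `L(χ(γ) − 1) = α^{−m} ∑_a χ(a)[a/p^m]⁺_f` (the second clause of the
tree's `IsPAdicLFunctionOf f p α L`, shared verbatim by `IsMultPAdicLFunctionOf` and
`IsSplitMultPAdicLFunctionOf`). Let `G ∈ Λ = ℤ_p⟦T⟧`, `G ≠ 0`, with `ι(G) = ϖ · L` for a constant `ϖ`
(an integral model of `L`: the census's Néron-normalised `ϖ·L_p(E,T)` when `c_den = 0`, or any
`p`-power multiple of it — `λ` is insensitive to the constant).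

* §1 `ratTwistedSymbolSum_ne_zero_of_lam_lt`: `λ(G) < φ(pⁿ⁺¹)` ⇒ every Birch sum
  `∑_a χ(a)[a/p^{n+1+e₀}]⁺_f` (`χ` primitive, even, of `p`-power order — the characters of
  `Γ = Gal(ℚ_∞/ℚ)` of order exactly `pⁿ⁺¹`) is NON-ZERO: were it zero, `L`, hence `G`, would vanish at
  `χ(γ) − 1`, a point `ζ − 1` with `ζ` of order `pⁿ⁺¹` (`orderOf_apply_cyclotomicGenerator`), and the
  sibling file's `totient_le_lam_of_hasSum_zero` would give `λ(G) ≥ φ(pⁿ⁺¹)`. NO `μ = 0` hypothesis,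
  no rationality of `L`.
  `forall_ratTwistedSymbolSum_ne_zero_of_lam_lt_sub_one`: `λ(G) ≤ p − 2` ⇒ the same at EVERY layer
  `n ≥ 1` (`φ(pⁿ) ≥ p − 1`).
* §2 complex side (`IsNewformOf W f`; Birch's formula is a tree theorem): `L(E, χ, 1) ≠ 0` for every
  such `χ` with values in `ℂ` and every entire continuation (`forall_twistedLValue_ne_zero_of_lam_lt…`),
  via gen 6's transport `forall_twistedLValue_ne_zero_of_padic`.
* §3 the tower (granted `hK`, `p ≠ 2`): `λ(G) ≤ p − 2` ⇒ for every `n`, every point of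
  `E(ℚ_n) = E(ℚ(ζ_{p^{n+1}}))^{μ_{p−1}}` has a positive multiple in the image of `E(ℚ)` — NO RANK GROWTH
  anywhere in the cyclotomic `ℤ_p`-tower (`exists_nsmul_mem_range_baseChange_layer_of_lam_lt_of_kato`,
  via gen 6's `exists_nsmul_mem_range_baseChange_layer_of_kato`).
* §5 census form: a UNIT coefficient of index `m` of an integral model gives `G ≠ 0`, `μ = 0`,
  `λ ≤ m` (`lam_le_of_norm_coeff_eq_one`), hence all of the above with `m + 2 ≤ p`
  (`ordinary_forall_twistedLValue_ne_zero_of_norm_coeff_eq_one`).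
* §4 instances: GOOD ORDINARY `p` — `L = L_p(E,T) = padicLFunction f (unitRoot W p)`, interpolation a
  tree THEOREM (`isPAdicLFunctionOf_padicLFunction_holds`): `ordinary_forall_twistedLValue_ne_zero`,
  `ordinary_exists_nsmul_mem_range_baseChange_layer_of_kato`; MULTIPLICATIVE `p` — THE function of
  `IsMultPAdicLFunctionOf f p ε L` / `IsSplitMultPAdicLFunctionOf f p L` (interpolation is part of the
  predicate): `mult_forall_twistedLValue_ne_zero`, `splitMult_forall_twistedLValue_ne_zero`.

So every census row `(μ_an, λ_an)` of iw-1 (good ordinary / multiplicative `p`) with `λ_an ≤ p − 2`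
carries, by theorem, the non-vanishing of ALL twisted central values `L(E, χ, 1)`, `χ ≠ 1` a character
of `Gal(ℚ_∞/ℚ)`, and (under Kato's Cor. 14.3 (2)) the constancy of the Mordell–Weil rank along the
tower; a row with `λ_an < φ(pⁿ⁺¹)` forbids arithmetic zeros at the layers `≥ n + 1` (complement of
eisenstein-p1's route C, `X1/CyclotomicZeros`: a vanishing twist at the FIRST layer needs `λ_an ≥ p − 1`).
Supersingular `p` (X6/X7/X8) is gen 6 (`Supersingular/MazurTateTwistedNonvanishing*`, Sprung's `L♯/L♭`).

References: [MazurTateTeitelbaum1986Invent] §I.12–I.14; [Washington1997] §7.1–7.2; [Kato2004Asterisque]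
Cor. 14.3 (2), Thm. 14.4; [GreenbergVatsal2000] (1)–(2); HOME/b2b-bsdres-additive-p3/X8-ROUTE-B.md §12.
-/

set_option autoImplicit false

noncomputable section

open scoped Classical MatrixGroups ModularForm

open CongruenceSubgroup Polynomial WeierstrassCurve Literature.NumberTheory.EllipticCurves
  Literature.NumberTheory.EllipticCurves.ModularForms
  Literature.NumberTheory.EllipticCurves.GreenbergVatsal2000
  Summit.BirchSwinnertonDyer.Rank1Residual.X1.MuLambda
  Summit.BirchSwinnertonDyer.Rank1Residual.X11a
  Summit.BirchSwinnertonDyer.Rank1Residual.X11a.LambdaNorm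
  Summit.BirchSwinnertonDyer.Rank1Residual.Supersingular

namespace Summit.BirchSwinnertonDyer.Rank1Residual.Iwasawa

variable {p : ℕ} [hp : Fact p.Prime] {N : ℕ} {f : CuspForm (Gamma0 N) 2}

/-! ## §1. `λ(G) < φ(pⁿ⁺¹)` ⇒ no vanishing Birch sum of order `pⁿ⁺¹` -/

section PAdic

/-- **No vanishing twist of order `pⁿ⁺¹` when `λ < φ(pⁿ⁺¹)`.** Let `L ∈ ℚ_p⟦T⟧` have the twisted
Mazur–Tate–Teitelbaum interpolation property for `(f, α)` (hypothesis `hI`: the second clause of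
`IsPAdicLFunctionOf f p α L`; no hypothesis on `α`), and let `G ∈ Λ ∖ {0}` with `ι(G) = ϖ · L`. If
`λ(G) < φ(pⁿ⁺¹)` then `∑_a χ(a) [a/p^{n+1+e₀}]⁺_f ≠ 0` for every primitive even `p`-power-order
Dirichlet character `χ` mod `p^{n+1+e₀}` with values in `ℂ_p`.
[cite: MazurTateTeitelbaum1986Invent, §I.13–I.14] [cite: Washington1997, §7.1–7.2 and Thm. 7.3] -/
theorem ratTwistedSymbolSum_ne_zero_of_lam_lt {α : ℚ_[p]} {L : PowerSeries ℚ_[p]}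
    (hI : ∀ (m : ℕ), 0 < m → ∀ χ : DirichletCharacter ℂ_[p] (p ^ m), χ.IsPrimitive → χ.Even →
      (∃ j : ℕ, orderOf χ = p ^ j) →
        HasSum (fun k : ℕ ↦ algebraMap ℚ_[p] ℂ_[p] (PowerSeries.coeff k L) *
            (χ (cyclotomicGenerator p : ZMod (p ^ m)) - 1) ^ k)
          (algebraMap ℚ_[p] ℂ_[p] (α⁻¹ ^ m) * ratTwistedSymbolSum f χ))
    {G : IwasawaAlgebra p} {ϖ : ℚ_[p]} (hG : iwasawaToPowerSeries p G = PowerSeries.C ϖ * L)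
    (hG0 : G ≠ 0) {n : ℕ} (hlam : lam G < Nat.totient (p ^ (n + 1)))
    (χ : DirichletCharacter ℂ_[p] (p ^ (n + 1 + cyclotomicExponent p))) (hχ : χ.IsPrimitive)
    (heven : χ.Even) (hord : ∃ j : ℕ, orderOf χ = p ^ j) :
    ratTwistedSymbolSum f χ ≠ 0 := by
  intro h0
  have hm0 : 0 < n + 1 + cyclotomicExponent p := by omega
  have hme : cyclotomicExponent p < n + 1 + cyclotomicExponent p := by omega
  -- `L(ζ - 1) = α^{-m} · 0 = 0`, `ζ = χ(γ)`
  have hsum := hI (n + 1 + cyclotomicExponent p) hm0 χ hχ heven hord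
  rw [h0, mul_zero] at hsum
  -- `ζ` has order exactly `p^{n+1}`
  have horder : orderOf (χ (cyclotomicGenerator p : ZMod (p ^ (n + 1 + cyclotomicExponent p)))) =
      p ^ (n + 1) := by
    rw [orderOf_apply_cyclotomicGenerator hme χ hχ heven hord, Nat.add_sub_cancel]
  have hζ : IsPrimitiveRoot (χ (cyclotomicGenerator p : ZMod (p ^ (n + 1 + cyclotomicExponent p))))
      (p ^ (n + 1)) := by
    rw [← horder]; exact IsPrimitiveRoot.orderOf _
  set ζ : ℂ_[p] := χ (cyclotomicGenerator p : ZMod (p ^ (n + 1 + cyclotomicExponent p))) with hζdef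
  -- `G(ζ - 1) = ϖ · L(ζ - 1) = 0`
  have hGsum : HasSum (fun k ↦ ((algebraMap ℚ_[p] ℂ_[p]).comp (algebraMap ℤ_[p] ℚ_[p]))
      (PowerSeries.coeff k G) * (ζ - 1) ^ k) 0 := by
    have h := hsum.mul_left (algebraMap ℚ_[p] ℂ_[p] ϖ)
    rw [mul_zero] at h
    refine h.congr_fun fun k ↦ ?_
    have hk : algebraMap ℤ_[p] ℚ_[p] (PowerSeries.coeff k G) = ϖ * PowerSeries.coeff k L := by
      have h1 := congr_arg (PowerSeries.coeff k) hG
      rw [iwasawaToPowerSeries, PowerSeries.coeff_map, PowerSeries.coeff_C_mul] at h1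
      exact h1
    show ((algebraMap ℚ_[p] ℂ_[p]).comp (algebraMap ℤ_[p] ℚ_[p])) (PowerSeries.coeff k G) * (ζ - 1) ^ k =
      algebraMap ℚ_[p] ℂ_[p] ϖ * (algebraMap ℚ_[p] ℂ_[p] (PowerSeries.coeff k L) * (ζ - 1) ^ k)
    rw [RingHom.comp_apply, hk, map_mul, mul_assoc]
  exact absurd hlam (not_lt.mpr (totient_le_lam_of_hasSum_zero hG0 hζ hGsum))

/-- **`λ(G) ≤ p − 2` ⇒ no vanishing Birch sum at ANY layer**: for every `n ≥ 1` and every primitive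
even `p`-power-order `χ` mod `p^{n+e₀}` with values in `ℂ_p`, `∑_a χ(a)[a/p^{n+e₀}]⁺_f ≠ 0`
(`φ(pⁿ) ≥ φ(p) = p − 1 > λ(G)`). [cite: MazurTateTeitelbaum1986Invent, §I.13–I.14] [cite: Washington1997, §7.1–7.2 and Thm. 7.3] -/
theorem forall_ratTwistedSymbolSum_ne_zero_of_lam_lt_sub_one {α : ℚ_[p]}
    {L : PowerSeries ℚ_[p]}
    (hI : ∀ (m : ℕ), 0 < m → ∀ χ : DirichletCharacter ℂ_[p] (p ^ m), χ.IsPrimitive → χ.Even →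
      (∃ j : ℕ, orderOf χ = p ^ j) →
        HasSum (fun k : ℕ ↦ algebraMap ℚ_[p] ℂ_[p] (PowerSeries.coeff k L) *
            (χ (cyclotomicGenerator p : ZMod (p ^ m)) - 1) ^ k)
          (algebraMap ℚ_[p] ℂ_[p] (α⁻¹ ^ m) * ratTwistedSymbolSum f χ))
    {G : IwasawaAlgebra p} {ϖ : ℚ_[p]} (hG : iwasawaToPowerSeries p G = PowerSeries.C ϖ * L)
    (hG0 : G ≠ 0) (hsmall : lam G + 1 < p) {n : ℕ} (hn : 0 < n)
    (χ : DirichletCharacter ℂ_[p] (p ^ (n + cyclotomicExponent p))) (hχ : χ.IsPrimitive)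
    (heven : χ.Even) (hord : ∃ j : ℕ, orderOf χ = p ^ j) : ratTwistedSymbolSum f χ ≠ 0 := by
  obtain ⟨n, rfl⟩ := Nat.exists_eq_succ_of_ne_zero hn.ne'
  refine ratTwistedSymbolSum_ne_zero_of_lam_lt hI hG hG0 (lt_of_lt_of_le (b := Nat.totient (p ^ 1)) ?_ ?_)
    χ hχ heven hord
  · rw [pow_one, Nat.totient_prime hp.out]
    omega
  · exact Nat.le_of_dvd (Nat.totient_pos.mpr (pow_pos hp.out.pos _))
      (Nat.totient_dvd_of_dvd (pow_dvd_pow p (Nat.le_add_left 1 n)))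

end PAdic

/-! ## §2. Complex side: `L(E, χ, 1) ≠ 0` -/

section Complex

variable [NeZero N] {W : WeierstrassCurve ℚ} [W.IsElliptic]

omit [W.IsElliptic] in
/-- **`λ(G) ≤ p − 2` ⇒ `L(E, χ, 1) ≠ 0` for every primitive even `p`-power-order `χ` of conductor
`p^{n+e₀}`, `n ≥ 1`, with values in `ℂ`** (`f` the newform of `E = W`; `L` any entire continuation of
`∑ χ(k) a_k k^{-s}`; Birch's formula PROVED in the tree; transport `ℂ_p ↝ ℂ` from gen 6).
[cite: MazurTateTeitelbaum1986Invent, §I.8 (8.6) and §I.13–I.14] -/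
theorem forall_twistedLValue_ne_zero_of_lam_lt_sub_one (hf : IsNewformOf W f) {α : ℚ_[p]}
    {L : PowerSeries ℚ_[p]}
    (hI : ∀ (m : ℕ), 0 < m → ∀ χ : DirichletCharacter ℂ_[p] (p ^ m), χ.IsPrimitive → χ.Even →
      (∃ j : ℕ, orderOf χ = p ^ j) →
        HasSum (fun k : ℕ ↦ algebraMap ℚ_[p] ℂ_[p] (PowerSeries.coeff k L) *
            (χ (cyclotomicGenerator p : ZMod (p ^ m)) - 1) ^ k)
          (algebraMap ℚ_[p] ℂ_[p] (α⁻¹ ^ m) * ratTwistedSymbolSum f χ))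
    {G : IwasawaAlgebra p} {ϖ : ℚ_[p]} (hG : iwasawaToPowerSeries p G = PowerSeries.C ϖ * L)
    (hG0 : G ≠ 0) (hsmall : lam G + 1 < p) {n : ℕ} (hn : 0 < n)
    (χ : DirichletCharacter ℂ (p ^ (n + cyclotomicExponent p))) (hχ : χ.IsPrimitive) (hev : χ.Even)
    (hord : ∃ j : ℕ, orderOf χ = p ^ j) {Lχ : ℂ → ℂ} (hLd : Differentiable ℂ Lχ)
    (hLχ : ∀ s : ℂ, 2 < s.re → Lχ s = twistedLSeries f χ s) : Lχ 1 ≠ 0 := by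
  haveI : NeZero (p ^ (n + cyclotomicExponent p)) := ⟨pow_ne_zero _ hp.out.ne_zero⟩
  exact forall_twistedLValue_ne_zero_of_padic (f := f) hf
    (fun χ' hχ' hev' hord' ↦ forall_ratTwistedSymbolSum_ne_zero_of_lam_lt_sub_one hI hG hG0 hsmall
      hn χ' hχ' hev' hord') χ hχ hev hord hLd hLχ

omit [W.IsElliptic] in
/-- Single-layer form: `λ(G) < φ(pⁿ⁺¹)` ⇒ `L(E, χ, 1) ≠ 0` for the characters of order `pⁿ⁺¹`
(conductor `p^{n+1+e₀}`). [cite: MazurTateTeitelbaum1986Invent, §I.8 (8.6) and §I.13–I.14] -/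
theorem twistedLValue_ne_zero_of_lam_lt (hf : IsNewformOf W f) {α : ℚ_[p]}
    {L : PowerSeries ℚ_[p]}
    (hI : ∀ (m : ℕ), 0 < m → ∀ χ : DirichletCharacter ℂ_[p] (p ^ m), χ.IsPrimitive → χ.Even →
      (∃ j : ℕ, orderOf χ = p ^ j) →
        HasSum (fun k : ℕ ↦ algebraMap ℚ_[p] ℂ_[p] (PowerSeries.coeff k L) *
            (χ (cyclotomicGenerator p : ZMod (p ^ m)) - 1) ^ k)
          (algebraMap ℚ_[p] ℂ_[p] (α⁻¹ ^ m) * ratTwistedSymbolSum f χ))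
    {G : IwasawaAlgebra p} {ϖ : ℚ_[p]} (hG : iwasawaToPowerSeries p G = PowerSeries.C ϖ * L)
    (hG0 : G ≠ 0) {n : ℕ} (hlam : lam G < Nat.totient (p ^ (n + 1)))
    (χ : DirichletCharacter ℂ (p ^ (n + 1 + cyclotomicExponent p))) (hχ : χ.IsPrimitive)
    (hev : χ.Even) (hord : ∃ j : ℕ, orderOf χ = p ^ j) {Lχ : ℂ → ℂ} (hLd : Differentiable ℂ Lχ)
    (hLχ : ∀ s : ℂ, 2 < s.re → Lχ s = twistedLSeries f χ s) : Lχ 1 ≠ 0 := by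
  haveI : NeZero (p ^ (n + 1 + cyclotomicExponent p)) := ⟨pow_ne_zero _ hp.out.ne_zero⟩
  exact forall_twistedLValue_ne_zero_of_padic (f := f) hf
    (fun χ' hχ' hev' hord' ↦ ratTwistedSymbolSum_ne_zero_of_lam_lt hI hG hG0 hlam χ' hχ' hev' hord')
    χ hχ hev hord hLd hLχ

end Complex

/-! ## §3. The tower: no rank growth (granted Kato's Cor. 14.3 (2)) -/

section Tower

variable [NeZero N] {W : WeierstrassCurve ℚ} [W.IsElliptic]

set_option backward.isDefEq.respectTransparency false in
/-- **`λ(G) ≤ p − 2` ⇒ no rank growth in the cyclotomic `ℤ_p`-tower (granted Kato).** `p ≠ 2`,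
`f` the newform of `E = W`, `L` with the twisted interpolation property for `(f, α)`,
`G ∈ Λ ∖ {0}` with `ι(G) = ϖ·L` and `λ(G) + 2 ≤ p`. Then, granted Kato's Cor. 14.3 (2) (`hK`), for
every `n` every point of `E(ℚ(ζ_{p^{n+1}}))` fixed by the `σ_η`, `η ∈ μ_{p−1}(ℤ_p)` — i.e. every point
of `E(ℚ_n)` — has a positive multiple in the image of `E(ℚ)`: `rank E(ℚ_n) = rank E(ℚ)` for all `n`.
[cite: Kato2004Asterisque, Cor. 14.3 (2) (p. 235) and Thm. 14.4 (p. 236)] -/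
theorem exists_nsmul_mem_range_baseChange_layer_of_lam_lt_of_kato
    (hK : kato_finite_chiPart_of_twistedLValue_ne_zero) (hp2 : p ≠ 2) (hf : IsNewformOf W f)
    {α : ℚ_[p]} {L : PowerSeries ℚ_[p]}
    (hI : ∀ (m : ℕ), 0 < m → ∀ χ : DirichletCharacter ℂ_[p] (p ^ m), χ.IsPrimitive → χ.Even →
      (∃ j : ℕ, orderOf χ = p ^ j) →
        HasSum (fun k : ℕ ↦ algebraMap ℚ_[p] ℂ_[p] (PowerSeries.coeff k L) *
            (χ (cyclotomicGenerator p : ZMod (p ^ m)) - 1) ^ k)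
          (algebraMap ℚ_[p] ℂ_[p] (α⁻¹ ^ m) * ratTwistedSymbolSum f χ))
    {G : IwasawaAlgebra p} {ϖ : ℚ_[p]} (hG : iwasawaToPowerSeries p G = PowerSeries.C ϖ * L)
    (hG0 : G ≠ 0) (hsmall : lam G + 1 < p)
    {n : ℕ} [NeZero (p ^ (n + cyclotomicExponent p))]
    [DecidableEq (CyclotomicField (p ^ (n + cyclotomicExponent p)) ℚ)]
    {P : (W.baseChange (CyclotomicField (p ^ (n + cyclotomicExponent p)) ℚ)).toAffine.Point}
    (hP : ∀ σ : CyclotomicField (p ^ (n + cyclotomicExponent p)) ℚ ≃ₐ[ℚ]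
        CyclotomicField (p ^ (n + cyclotomicExponent p)) ℚ,
      (∃ w : rootsOfUnity (torsionOrder p) ℤ_[p],
        IsCyclotomicExtension.autEquivPow (CyclotomicField (p ^ (n + cyclotomicExponent p)) ℚ)
            (cyclotomic.irreducible_rat (NeZero.pos (p ^ (n + cyclotomicExponent p)))) σ =
          Units.map (PadicInt.toZModPow (n + cyclotomicExponent p)).toMonoidHom (w : ℤ_[p]ˣ)) →
      Affine.Point.map (W' := W.toAffine)
        (σ : CyclotomicField (p ^ (n + cyclotomicExponent p)) ℚ →ₐ[ℚ]
          CyclotomicField (p ^ (n + cyclotomicExponent p)) ℚ) P = P) :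
    ∃ m : ℕ, 0 < m ∧ m • P ∈ Set.range
      (Affine.Point.baseChange (W' := W.toAffine) ℚ
        (CyclotomicField (p ^ (n + cyclotomicExponent p)) ℚ)) :=
  exists_nsmul_mem_range_baseChange_layer_of_kato hK hp2 hf
    (fun _ hk _ χ hχ hev hord _ hLd hLχ ↦
      forall_twistedLValue_ne_zero_of_lam_lt_sub_one hf hI hG hG0 hsmall hk χ hχ hev hord hLd hLχ)
    hP

end Tower

/-! ## §4. Instances: good ordinary `p` (`L_p(E,T)`), multiplicative `p` (MTT) -/

section Ordinary

variable [NeZero N] {W : WeierstrassCurve ℚ} [W.IsElliptic] [W.IsGloballyMinimal]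

/-- **GOOD ORDINARY `p`: `λ_an ≤ p − 2` ⇒ `L(E, χ, 1) ≠ 0` for every non-trivial character `χ` of
`Gal(ℚ_∞/ℚ)`** — precisely: for `f` the newform of `E = W`, `p` good ordinary, and ANY integral model
`G ∈ Λ ∖ {0}`, `ι(G) = ϖ · L_p(E,T)` (`L_p(E,T) = padicLFunction f (unitRoot W p)`; the interpolation
property is the tree THEOREM `isPAdicLFunctionOf_padicLFunction_holds`) with `λ(G) + 2 ≤ p`: for every
`n ≥ 1`, every primitive even `p`-power-order `χ` mod `p^{n+e₀}` and every entire continuation `Lχ` of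
the twisted series, `Lχ(1) ≠ 0`. The census datum is `λ(G) = λ_an(E, p)` (iw-1, two engines).
[cite: MazurSwinnertonDyer1974Invent, §9] [cite: MazurTateTeitelbaum1986Invent, §I.14 (14.3)] -/
theorem ordinary_forall_twistedLValue_ne_zero (hord : IsOrdinaryAt W p) (hf : IsNewformOf W f)
    {G : IwasawaAlgebra p} {ϖ : ℚ_[p]}
    (hG : iwasawaToPowerSeries p G = PowerSeries.C ϖ * padicLFunction f (unitRoot W p : ℚ_[p]))
    (hG0 : G ≠ 0) (hsmall : lam G + 1 < p) {n : ℕ} (hn : 0 < n)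
    (χ : DirichletCharacter ℂ (p ^ (n + cyclotomicExponent p))) (hχ : χ.IsPrimitive) (hev : χ.Even)
    (hordχ : ∃ j : ℕ, orderOf χ = p ^ j) {Lχ : ℂ → ℂ} (hLd : Differentiable ℂ Lχ)
    (hLχ : ∀ s : ℂ, 2 < s.re → Lχ s = twistedLSeries f χ s) : Lχ 1 ≠ 0 :=
  forall_twistedLValue_ne_zero_of_lam_lt_sub_one hf
    (isPAdicLFunctionOf_padicLFunction_holds hord hf).2 hG hG0 hsmall hn χ hχ hev hordχ hLd hLχ

/-- **GOOD ORDINARY `p`, single layer: `λ_an < φ(pⁿ⁺¹)` ⇒ `L(E, χ, 1) ≠ 0` for the characters of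
order `pⁿ⁺¹`.** [cite: MazurSwinnertonDyer1974Invent, §9] [cite: MazurTateTeitelbaum1986Invent, §I.14 (14.3)] -/
theorem ordinary_twistedLValue_ne_zero_of_lam_lt (hord : IsOrdinaryAt W p) (hf : IsNewformOf W f)
    {G : IwasawaAlgebra p} {ϖ : ℚ_[p]}
    (hG : iwasawaToPowerSeries p G = PowerSeries.C ϖ * padicLFunction f (unitRoot W p : ℚ_[p]))
    (hG0 : G ≠ 0) {n : ℕ} (hlam : lam G < Nat.totient (p ^ (n + 1)))
    (χ : DirichletCharacter ℂ (p ^ (n + 1 + cyclotomicExponent p))) (hχ : χ.IsPrimitive)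
    (hev : χ.Even) (hordχ : ∃ j : ℕ, orderOf χ = p ^ j) {Lχ : ℂ → ℂ} (hLd : Differentiable ℂ Lχ)
    (hLχ : ∀ s : ℂ, 2 < s.re → Lχ s = twistedLSeries f χ s) : Lχ 1 ≠ 0 :=
  twistedLValue_ne_zero_of_lam_lt hf
    (isPAdicLFunctionOf_padicLFunction_holds hord hf).2 hG hG0 hlam χ hχ hev hordχ hLd hLχ

set_option backward.isDefEq.respectTransparency false in
/-- **GOOD ORDINARY `p`: `λ_an ≤ p − 2` ⇒ (granted Kato's Cor. 14.3 (2)) no rank growth in the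
cyclotomic `ℤ_p`-tower**, `p ≠ 2`. [cite: Kato2004Asterisque, Cor. 14.3 (2) (p. 235) and Thm. 14.4 (p. 236)] -/
theorem ordinary_exists_nsmul_mem_range_baseChange_layer_of_kato
    (hK : kato_finite_chiPart_of_twistedLValue_ne_zero) (hp2 : p ≠ 2) (hord : IsOrdinaryAt W p)
    (hf : IsNewformOf W f) {G : IwasawaAlgebra p} {ϖ : ℚ_[p]}
    (hG : iwasawaToPowerSeries p G = PowerSeries.C ϖ * padicLFunction f (unitRoot W p : ℚ_[p]))
    (hG0 : G ≠ 0) (hsmall : lam G + 1 < p)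
    {n : ℕ} [NeZero (p ^ (n + cyclotomicExponent p))]
    [DecidableEq (CyclotomicField (p ^ (n + cyclotomicExponent p)) ℚ)]
    {P : (W.baseChange (CyclotomicField (p ^ (n + cyclotomicExponent p)) ℚ)).toAffine.Point}
    (hP : ∀ σ : CyclotomicField (p ^ (n + cyclotomicExponent p)) ℚ ≃ₐ[ℚ]
        CyclotomicField (p ^ (n + cyclotomicExponent p)) ℚ,
      (∃ w : rootsOfUnity (torsionOrder p) ℤ_[p],
        IsCyclotomicExtension.autEquivPow (CyclotomicField (p ^ (n + cyclotomicExponent p)) ℚ)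
            (cyclotomic.irreducible_rat (NeZero.pos (p ^ (n + cyclotomicExponent p)))) σ =
          Units.map (PadicInt.toZModPow (n + cyclotomicExponent p)).toMonoidHom (w : ℤ_[p]ˣ)) →
      Affine.Point.map (W' := W.toAffine)
        (σ : CyclotomicField (p ^ (n + cyclotomicExponent p)) ℚ →ₐ[ℚ]
          CyclotomicField (p ^ (n + cyclotomicExponent p)) ℚ) P = P) :
    ∃ m : ℕ, 0 < m ∧ m • P ∈ Set.range
      (Affine.Point.baseChange (W' := W.toAffine) ℚ
        (CyclotomicField (p ^ (n + cyclotomicExponent p)) ℚ)) :=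
  exists_nsmul_mem_range_baseChange_layer_of_lam_lt_of_kato hK hp2 hf
    (isPAdicLFunctionOf_padicLFunction_holds hord hf).2 hG hG0 hsmall hP

end Ordinary

section Multiplicative

variable [NeZero N] {W : WeierstrassCurve ℚ} [W.IsElliptic]

omit [W.IsElliptic] in
/-- **MULTIPLICATIVE `p` (non-split normal form `ε = −1`, or any `ε`): `λ_an ≤ p − 2` ⇒ `L(E, χ, 1) ≠ 0`
for every non-trivial character of `Gal(ℚ_∞/ℚ)`** — for THE Mazur–Tate–Teitelbaum function `L` of
`IsMultPAdicLFunctionOf f p ε L` (the interpolation property is part of the predicate) and any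
integral model `G ∈ Λ ∖ {0}`, `ι(G) = ϖ · L`, with `λ(G) + 2 ≤ p`.
[cite: MazurTateTeitelbaum1986Invent, §I.14 (14.3) and §I.15] -/
theorem mult_forall_twistedLValue_ne_zero (hf : IsNewformOf W f) {ε : ℚ_[p]}
    {L : PowerSeries ℚ_[p]} (hL : IsMultPAdicLFunctionOf f p ε L) {G : IwasawaAlgebra p}
    {ϖ : ℚ_[p]} (hG : iwasawaToPowerSeries p G = PowerSeries.C ϖ * L) (hG0 : G ≠ 0)
    (hsmall : lam G + 1 < p) {n : ℕ} (hn : 0 < n)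
    (χ : DirichletCharacter ℂ (p ^ (n + cyclotomicExponent p))) (hχ : χ.IsPrimitive) (hev : χ.Even)
    (hordχ : ∃ j : ℕ, orderOf χ = p ^ j) {Lχ : ℂ → ℂ} (hLd : Differentiable ℂ Lχ)
    (hLχ : ∀ s : ℂ, 2 < s.re → Lχ s = twistedLSeries f χ s) : Lχ 1 ≠ 0 :=
  forall_twistedLValue_ne_zero_of_lam_lt_sub_one hf hL.2.2 hG hG0 hsmall hn χ hχ hev hordχ hLd hLχ

omit [W.IsElliptic] in
/-- **SPLIT MULTIPLICATIVE `p`: the same for THE function of `IsSplitMultPAdicLFunctionOf f p L`**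
(`α = 1`; the trivial zero sits at `T = 0`, not at the `ζ − 1`, and is counted by `λ`).
[cite: MazurTateTeitelbaum1986Invent, §I.14 (14.3) and §I.15] -/
theorem splitMult_forall_twistedLValue_ne_zero (hf : IsNewformOf W f) {L : PowerSeries ℚ_[p]}
    (hL : IsSplitMultPAdicLFunctionOf f p L) {G : IwasawaAlgebra p} {ϖ : ℚ_[p]}
    (hG : iwasawaToPowerSeries p G = PowerSeries.C ϖ * L) (hG0 : G ≠ 0) (hsmall : lam G + 1 < p)
    {n : ℕ} (hn : 0 < n) (χ : DirichletCharacter ℂ (p ^ (n + cyclotomicExponent p)))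
    (hχ : χ.IsPrimitive) (hev : χ.Even) (hordχ : ∃ j : ℕ, orderOf χ = p ^ j) {Lχ : ℂ → ℂ}
    (hLd : Differentiable ℂ Lχ) (hLχ : ∀ s : ℂ, 2 < s.re → Lχ s = twistedLSeries f χ s) :
    Lχ 1 ≠ 0 :=
  forall_twistedLValue_ne_zero_of_lam_lt_sub_one hf hL.2.2 hG hG0 hsmall hn χ hχ hev hordχ hLd hLχ

end Multiplicative

/-! ## §5. Certificate form: a UNIT coefficient of index `m` gives `λ ≤ m` (the census datum) -/

section Certificate

/-- **A unit coefficient bounds `λ`**: if `‖[T^m] G‖ = 1` for `G ∈ Λ` then `G ≠ 0`, `μ(G) = 0` and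
`λ(G) ≤ m` (`λ` = the least index of a unit coefficient). This is the per-pair datum of iw-1's census
(`certs/iw/<label>@<p>.json`: "coefficient of index `λ_an` of `ϖ·L_p` is a `p`-adic unit").
[cite: GreenbergVatsal2000, p. 2–3, (1)–(2)] [cite: Washington1997, §7.1] -/
theorem lam_le_of_norm_coeff_eq_one {G : IwasawaAlgebra p} {m : ℕ}
    (h : ‖(PowerSeries.coeff m G : ℤ_[p])‖ = 1) : G ≠ 0 ∧ mu G = 0 ∧ lam G ≤ m := by
  have hG : HasUnitContent G := (hasUnitContent_iff_exists_norm_eq_one G).mpr ⟨m, h⟩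
  refine ⟨ne_zero_of_hasUnitContent hG, mu_eq_zero_of_hasUnitContent hG, ?_⟩
  rw [lam_eq_normLam hG]
  exact normLam_le_of_isMaxCoeffAt (isMaxCoeffAt_of_norm_eq_one h)

/-- The same read on `ι(G) = F ∈ ℚ_p⟦T⟧`: `‖[T^m] F‖ = 1 ⇒ G ≠ 0 ∧ μ(G) = 0 ∧ λ(G) ≤ m`.
[cite: GreenbergVatsal2000, p. 2–3, (1)–(2)] -/
theorem lam_le_of_norm_coeff_iota_eq_one {G : IwasawaAlgebra p} {F : PowerSeries ℚ_[p]} {m : ℕ}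
    (hG : iwasawaToPowerSeries p G = F) (h : ‖PowerSeries.coeff m F‖ = 1) :
    G ≠ 0 ∧ mu G = 0 ∧ lam G ≤ m :=
  lam_le_of_norm_coeff_eq_one
    (norm_coeff_eq_one_of_iota_X_pow_mul_eq 0 m (by simpa using hG) (by simpa using h))

variable [NeZero N] {W : WeierstrassCurve ℚ} [W.IsElliptic] [W.IsGloballyMinimal]

/-- **GOOD ORDINARY `p`, census form**: an integral model `ι(G) = ϖ·L_p(E,T)` whose coefficient of
index `m` is a `p`-adic UNIT, with `m + 2 ≤ p`, forbids every vanishing twist `L(E, χ, 1) = 0`,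
`χ ≠ 1` a character of `Gal(ℚ_∞/ℚ)` (all layers `n ≥ 1`). [cite: MazurSwinnertonDyer1974Invent, §9]
[cite: GreenbergVatsal2000, p. 2–3, (1)–(2)] -/
theorem ordinary_forall_twistedLValue_ne_zero_of_norm_coeff_eq_one (hord : IsOrdinaryAt W p)
    (hf : IsNewformOf W f) {G : IwasawaAlgebra p} {ϖ : ℚ_[p]}
    (hG : iwasawaToPowerSeries p G = PowerSeries.C ϖ * padicLFunction f (unitRoot W p : ℚ_[p]))
    {m : ℕ} (hcoeff : ‖PowerSeries.coeff m
      (PowerSeries.C ϖ * padicLFunction f (unitRoot W p : ℚ_[p]))‖ = 1) (hm : m + 1 < p)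
    {n : ℕ} (hn : 0 < n) (χ : DirichletCharacter ℂ (p ^ (n + cyclotomicExponent p)))
    (hχ : χ.IsPrimitive) (hev : χ.Even) (hordχ : ∃ j : ℕ, orderOf χ = p ^ j) {Lχ : ℂ → ℂ}
    (hLd : Differentiable ℂ Lχ) (hLχ : ∀ s : ℂ, 2 < s.re → Lχ s = twistedLSeries f χ s) :
    Lχ 1 ≠ 0 := by
  obtain ⟨hG0, -, hlam⟩ := lam_le_of_norm_coeff_iota_eq_one hG hcoeff
  exact ordinary_forall_twistedLValue_ne_zero hord hf hG hG0 (by omega) hn χ hχ hev hordχ hLd hLχ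

end Certificate

end Summit.BirchSwinnertonDyer.Rank1Residual.Iwasawa

end
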